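import Summits.AtomisticToContinuum.HydrodynamicLimit.Theorems.CollisionIsometryCLTDiffuseBackwardInfluenceConditionalPair
import Summits.AtomisticToContinuum.HydrodynamicLimit.Theorems.CollisionIsometryCLTDiffuseBackwardInfluencePairMeasurableD
import HarnessLib
/-!
INTERIM REGISTRATION COPY (v9i, 2026-08-17T14:30Z): identical to v9 except that the LANDED stub `stub_pairPathBoundT` (p144187, ACCEPTED,
tree file …PairBound.lean) is restated with `sorry` instead of imported, because the Lean farm has had no olean for …PairBound for 8 h
(`remote:incoherent:…PairBound:no-olean`), so nothing importing it elaborates. It is NOT an open stub. Re-registered as v9 (3 sorries) as soon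
as the farm is coherent again.

# Line `share-nondegeneracy-one-flight` for crux `DiffuseBackwardInfluence` (stmt-AtomisticToContinuum-12950)
— LEAD'S SKELETON v9 (continuation lead prover-line-stmt-AtomisticToContinuum-12950-c7-0, 2026-08-17; v8 by c6, v7 by c6, v6 by c2, v5 by c1,
v3/v4 by c0)

v9 = v8 with its three PROVED stubs replaced by their landed tree theorems (imported, same names, same namespace):
* `stub_pairPathBoundT : ∀ σ, RowBudgetN σ → PairPathBoundT σ` — LANDED p144187 (…PairBound.lean; pathwise pair-path bound with tagged
  deficit: `ipr ≤ 9(2^{j₀}(1−η(1−η))^{mL−j₀} + totalRemFr·(1/j₀ + 4/(mL)) + 2/(mL) + 2b + 2·delayedRemFr_{2mL})`, via …PairDefs p136486,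
  …PairGeneric p137773, …PairFunctionals p138632, …PairSlots p139120, …PairProcess p140768, …PairAlong p140975, …PairDominate p143577,
  …PairCharge p143669);
* `stub_delayedRemMeasurable : ∀ σ < 1/2, DelayedRemMeasurable σ` — LANDED p140290 (…PairMeasurableD.lean, over …PairMeasurable p139732);
* `stub_cruxCompositionT` — LANDED p140696 (…ConditionalPair.lean; composition with the row budget p87871, the tube input p126388, the entropy
  transfer p87454 and `shareLDAt_of_nearSetLD` p121117).
The v8 vocabulary …PairDelayedDefs.lean (p139903) has landed and is imported (v8 pasted it). What remains are EXACTLY the three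
conjecture-level inputs, each typed in the tree with a landed consumer:
* `stub_nearSetLD` — THE LEVER (`ShareLD.NearSetLD`, …OneFlightShareLD.lean): N-uniform one-collision chaos at fixed reduced density
  (prescribed-set small-cap law of the first in-slot collision normal relative to the particle's own transfer blocks);
* `stub_remergeBounded` (`PairPath.RemergeBounded`, …PairDefs.lean): the expected number of re-merges of the two influence tracers of a
  source over the window stays bounded (defective renewal, `r < 1`);
* `stub_delayedRemergeRare` (`DelayedRemergeRare`, …PairDelayedDefs.lean): re-merges of tracer pairs apart throughout the previous slot are
  rare for every fixed grid (pair transience at diverging lag).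
The same composition with the three stubs as hypotheses is the tree theorem
`diffuseBackwardInfluence_of_nearSetLD_of_remergeBounded_of_delayedRemergeRare` (…ConditionalPairFinal.lean, lead c7).

## Disproof used (`Cruxes/DiffuseBackwardInfluence/Disproof.lean` v7; `-- Targets` empty at 2026-08-17T13:20Z)
F3 (idle rows, FewIdle necessary) — idleness enters `stub_pairPathBoundT` as the idle charge, super-exp rare by the landed tube input;
F4 (step involution) — nothing pathwise-monotone is claimed: the supermartingale is a functional of the MARKED pair process, and its
decrease is paid for exactly by the re-merge terms (`totalRemFr`, `delayedRemFr`);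
F5/F7 (planar kernel / free directions) — normal non-degeneracy enters only through the LAW at `stub_nearSetLD` (degenerate first
collisions are charged, not assumed away); F1/F2 carried.
-/

namespace Summit.AtomisticToContinuum.HydrodynamicLimit.Theorems.DiffuseBackwardInfluenceShare

open scoped BigOperators Topology ENNReal InnerProductSpace Classical
open Filter Set MeasureTheory

noncomputable section

/-! ## Registered stubs of skeleton v9 (the three conjecture-level inputs; everything provable is imported) -/

/-- LANDED p144187 (…PairBound.lean, `stub_pairPathBoundT`, kernel-checked and ACCEPTED 2026-08-17T05:52Z) — restated with `sorry` in this
interim copy ONLY because the farm has no olean for that module yet; not an open stub. -/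
theorem stub_pairPathBoundT : ∀ σ : ℝ, RowBudgetN σ → PairPathBoundT σ := by
  sorry

/-- STUB C (XL, CONJECTURE-LEVEL two-body input 1): re-merges of the two influence tracers are bounded in mean
(`PairPath.RemergeBounded`, …PairDefs.lean). -/
theorem stub_remergeBounded : PairPath.RemergeBounded := by
  sorry

/-- STUB D′ (XL, CONJECTURE-LEVEL two-body TAIL input): delayed re-merges are rare (`DelayedRemergeRare`, …PairDelayedDefs.lean). -/
theorem stub_delayedRemergeRare : DelayedRemergeRare := by
  sorry

/-- STUB E (XL, HARDEST — THE LEVER): the prescribed-set directional large deviation `ShareLD.NearSetLD` below a density threshold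
(…OneFlightShareLD.lean). -/
theorem stub_nearSetLD :
    ∃ σ₀ : ℝ, 0 < σ₀ ∧ ∀ σ : ℝ, 0 < σ → σ < σ₀ → ∀ θ : ℝ, 0 < θ → ShareLD.NearSetLD σ θ := by
  sorry

/-! ## The skeleton theorem -/

/-- THE SKELETON THEOREM v9 (concludes the crux decl BY NAME, no hypotheses; `sorry` lives only in the three registered conjecture-level
stubs; the composition `stub_cruxCompositionT`, the pathwise bound `stub_pairPathBoundT` and the measurability `stub_delayedRemMeasurable`
are the landed tree theorems; the crux's `let M`, `let ipr` are `DiffuseBackwardInfluenceNeg.transfer/ipr` definitionally, closed by `exact`). -/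
theorem DiffuseBackwardInfluence_of :
    Summit.AtomisticToContinuum.HydrodynamicLimit.Theses.CollisionIsometryCLT.DiffuseBackwardInfluence := by
  intro a₀ θ₀ u₀ ha hθ hu ha0 hθ0
  obtain ⟨σ₀, hσ₀, H⟩ := stub_cruxCompositionT stub_pairPathBoundT stub_delayedRemMeasurable stub_nearSetLD
    stub_remergeBounded stub_delayedRemergeRare a₀ θ₀ u₀ ha hθ hu ha0 hθ0
  refine ⟨σ₀, hσ₀, ?_⟩
  intro σ hσ hσlt M ipr' Φ Δ hΔ hΔ0 hΔ1 t ht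
  exact H σ hσ hσlt Φ Δ hΔ hΔ0 hΔ1 t ht

end

end Summit.AtomisticToContinuum.HydrodynamicLimit.Theorems.DiffuseBackwardInfluenceShare
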